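import Summits.BirchSwinnertonDyer.BirchSwinnertonDyer.Theorems.KolyvaginRankRigidityAtTwoSwapFromPiecesPrelims
import Summits.BirchSwinnertonDyer.BirchSwinnertonDyer.Theorems.KolyvaginRankRigidityAtTwoWalkBridge
import Summits.BirchSwinnertonDyer.BirchSwinnertonDyer.Theorems.KolyvaginRankRigidityAtTwoSwapOfNamedFacts
import Summits.BirchSwinnertonDyer.BirchSwinnertonDyer.Theorems.KolyvaginRankRigidityAtTwoSwapPairingLowerBoundGlobalOfIndex
import Summits.BirchSwinnertonDyer.BirchSwinnertonDyer.Theorems.GenusKolyvaginAtTwoVisiblePairAtTwoKolyvaginClassSign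
import HarnessLib

/-!
# Crux U1 `KolyvaginBoundedDefectAtTwo` (stmt-BirchSwinnertonDyer-28083), LINE 17 `kolyvagin_swap` — OSR
# `OppositeSignReciprocityAtTwo` (pen v7.7 l.543, typed sub-target of SWα), part 1/3: the k-TERM RECIPROCITY with a Kummer partner
# (`sum_localTatePairing_eq_zero_of_placesDividing_subset`) and a structure lemma (shrinking the transverse set of `𝓕(S)`)

Authored by the pen `bsd-idea-1` g15 (planner; HOME `line17/OppositeSignReciprocityAtTwo.lean` sha16 67c18ff6e0b42450, farm rc 0,
critic #322 reproduced); landed (split into three files ≤ 400 lines, statements unchanged, §4's inline `def` dropped in favour of the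
verbatim body) by width seat `bsd-line-krr2-p2` g18, `--supports stmt-BirchSwinnertonDyer-28083` (helper). THEOREMS ONLY; the end
result is CONDITIONAL on `prop37_2_frobeniusCongruence` (the registered print stub P372 of the line of record); nothing here proves
SWα, U1, a rung or BSD. BSD is NOT proved.

The two-term reciprocity `localTatePairing_add_eq_zero_of_swap` (piece P6 of S1, landed) evaluates Poitou–Tate for an auxiliary
class RELAXED at one place.  OSR's partner is not relaxed: it is a class `w ∈ H¹_{𝓕(m)}(K, E[p^k])` (transverse at the places of
`m`, Kummer elsewhere), paired with a class `C ∈ H¹_{𝓕(c)}(K, E[p^k])` (transverse at the places of `c ⊇` places of `m`, Kummer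
elsewhere).  Every local term of `Σ_v ⟨w_v, (w_* C)_v⟩_v = 0` at a place where the two structures AGREE vanishes (places of `m`: both
transverse, `𝒯` self-dual by `h𝒯sd`; places off `c`: both Kummer, exact Kummer self-duality; infinite places: complex), so
**the local terms at the places of `c` NOT dividing `m` sum to zero**:
`Σ_{v ∣ c, v ∤ m} ⟨w, C⟩_v = 0` — `sum_localTatePairing_eq_zero_of_placesDividing_subset`.  With `c = n·ℓ`, `m ∣ n`, this is
`B_ℓ + Σ_{q' ∣ n/m} ⟨w, C⟩_{q'} = 0`, the backbone of OSR's proof map (card §v7.7 (1)).  Same currency and hypotheses as P6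
(any prime-power level `p^k`, so also `2^M`; `K` imaginary quadratic; Howard's dual structures; the Weil transport).
`mem_selmerGroup_selmerF_of_subset`: a class of `H¹_{𝓕(S)}` that is Kummer at the places of `S` outside `S' ⊆ S` lies in `H¹_{𝓕(S')}`.
References (locators only; no cited FACT is declared): [cite: Kolyvagin1991MathAnn, §2 (proof of Thm. 2.2, ref. [1] Prop. 8)]
[cite: McCallumLMS1991, §5 proof of Prop. 5.2] [cite: Howard2004HeegnerKolyvagin, Def. 2.1.6, Thm. 2.1.11] [cite: MilneADT2006, Ch. I, Thm. 4.10(b)]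
[cite: Jetchev2008, §3.4.1 (p. 816)].
Design: no definitions; `K : Type`; axioms `propext`, `Classical.choice`, `Quot.sound`.
-/

set_option autoImplicit false
-- the Theorems namespace of this sub repeats the summit name by design (D-0017 nested layout)
set_option linter.dupNamespace false

noncomputable section

open scoped Classical Pointwise
open Function NumberField IsDedekindDomain WeierstrassCurve Field
open Literature.NumberTheory.EllipticCurves Literature.NumberTheory.GaloisRepresentations
open Literature.NumberTheory.EllipticCurves.Jetchev2008 Literature.NumberTheory.EllipticCurves.ModularForms
open Literature.NumberTheory.GaloisCohomology
open Literature.NumberTheory.GaloisRepresentations.DiscreteGaloisModule (localTatePairingZMod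
  tateDual SelmerStructure)
open Summit.BirchSwinnertonDyer.Rank1Residual.JET.SelmerVocabulary
open Summit.BirchSwinnertonDyer.Rank1Residual.JET.GlobalDuality

namespace Summit.BirchSwinnertonDyer.BirchSwinnertonDyer.Theorems.KolyvaginLowerBoundAtTwo

section KTerm

variable {K : Type} [Field K] [NumberField K] (W : WeierstrassCurve ℚ) [W.IsElliptic]
  [(W.baseChange K).IsElliptic]
  (p k : ℕ) [Fact p.Prime] [NeZero (p ^ k)]
  [Finite (geomTorsion (W.baseChange K) ((p ^ k : ℕ) : ℤ))]
  (e : geomTorsion (W.baseChange K) ((p ^ k : ℕ) : ℤ) → geomTorsion (W.baseChange K) ((p ^ k : ℕ) : ℤ) →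
    AlgebraicClosure K)
  (hμ : ∀ S T, e S T ^ (p ^ k) = 1)
  (hadd₁ : ∀ S₁ S₂ T, e (S₁ + S₂) T = e S₁ T * e S₂ T)
  (hadd₂ : ∀ S T₁ T₂, e S (T₁ + T₂) = e S T₁ * e S T₂)
  (hgal : ∀ (g : absoluteGaloisGroup K) (S T : geomTorsion (W.baseChange K) ((p ^ k : ℕ) : ℤ)),
    g • e S T = e (g • S) (g • T))
  (halt : ∀ T, e T T = 1) (hnondeg : ∀ T, (∀ S, e S T = 1) → T = 0)

include halt hnondeg in
/-- **k-term reciprocity (Kummer partner).**  `K` imaginary quadratic, level `p^k` (`k ≥ 1`), `𝒯` a transverse family self-dual under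
the Weil transport at the places of `c`, and the places of `m` among those of `c`.  For `w ∈ H¹_{𝓕(m)}(K, E[p^k])` and
`C ∈ H¹_{𝓕(c)}(K, E[p^k])`, the local Tate pairings of `w` with the Weil transport of `C` at the places dividing `c` but not `m`
sum to zero.  (The terms at the places of `m` — both transverse — and off `c` — both Kummer — vanish one by one.)
[cite: Kolyvagin1991MathAnn, §2 (ref. [1] Prop. 8)] [cite: McCallumLMS1991, §5 proof of Prop. 5.2]
[cite: Howard2004HeegnerKolyvagin, Def. 2.1.6, Thm. 2.1.11] -/
theorem sum_localTatePairing_eq_zero_of_placesDividing_subset (hK : IsImaginaryQuadratic K) (hk : 1 ≤ k)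
    (inv : LocalInvariants K (p ^ k))
    (hinv : ∀ v : HeightOneSpectrum (𝓞 K), Injective (inv (Sum.inr v)))
    (hvan : inv.SumLocalTermEqZero)
    (𝒯 : SelmerStructure ((W.baseChange K).torsionGaloisModule ((p ^ k : ℕ) : ℤ))) {c m : ℕ}
    (h𝒯sd : ∀ v ∈ placesDividing K c,
      inv.dualTransported 𝒯 (weilDualIntertwining (W.baseChange K) (p ^ k) e hμ hadd₁ hadd₂ hgal) (Sum.inr v) =
        𝒯 (Sum.inr v))
    (hmc : placesDividing K m ⊆ placesDividing K c)
    (w C : galoisCohomology ((W.baseChange K).torsionGaloisModule ((p ^ k : ℕ) : ℤ)) 1)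
    (hw : w ∈ (selmerF W ((p ^ k : ℕ) : ℤ) 𝒯 (placesDividing K m)).selmerGroup)
    (hC : C ∈ (selmerF W ((p ^ k : ℕ) : ℤ) 𝒯 (placesDividing K c)).selmerGroup) :
    ∑ v ∈ placesDividing K c \ placesDividing K m,
      localTatePairingZMod ((W.baseChange K).torsionGaloisModule ((p ^ k : ℕ) : ℤ)) (p ^ k) (Sum.inr v) (inv (Sum.inr v))
        (galoisCohomology.localization ((W.baseChange K).torsionGaloisModule ((p ^ k : ℕ) : ℤ)) (Sum.inr v) 1 w)
        (galoisCohomology.localization (((W.baseChange K).torsionGaloisModule ((p ^ k : ℕ) : ℤ)).tateDual (p ^ k)) (Sum.inr v) 1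
          (galoisCohomology.map (weilDualIntertwining (W.baseChange K) (p ^ k) e hμ hadd₁ hadd₂ hgal) 1 C)) = 0 := by
  have hpr : p.Prime := Fact.out
  set 𝓕 := selmerF W ((p ^ k : ℕ) : ℤ) 𝒯 (placesDividing K c) with h𝓕
  set 𝓖 := selmerF W ((p ^ k : ℕ) : ℤ) 𝒯 (placesDividing K m) with h𝓖
  set y := galoisCohomology.map (weilDualIntertwining (W.baseChange K) (p ^ k) e hμ hadd₁ hadd₂ hgal) 1 C
    with hy
  have hM : ∀ P : geomTorsion (W.baseChange K) ((p ^ k : ℕ) : ℤ), (p ^ k) • P = 0 := fun P => by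
    simpa using (W.baseChange K).natAbs_nsmul_geomTorsion P
  -- (1) the transport of `C` lies in the dual Selmer group of `𝓕 = 𝓕(c)` (self-duality)
  have hsd : inv.dualTransported 𝓕 (weilDualIntertwining (W.baseChange K) (p ^ k) e hμ hadd₁ hadd₂ hgal) = 𝓕 :=
    funext (dualTransported_selmerF_eq_of_isImaginaryQuadratic W p k e hμ hadd₁ hadd₂ hgal halt hnondeg
      hK hk inv hinv 𝒯 c h𝒯sd)
  have hyd : y ∈ (inv.dualSelmerStructure ((W.baseChange K).torsionGaloisModule ((p ^ k : ℕ) : ℤ)) 𝓕).selmerGroup := by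
    have h : C ∈ ((inv.dualSelmerStructure ((W.baseChange K).torsionGaloisModule ((p ^ k : ℕ) : ℤ)) 𝓕).selmerGroup).comap
        (galoisCohomology.map (weilDualIntertwining (W.baseChange K) (p ^ k) e hμ hadd₁ hadd₂ hgal) 1) := by
      rw [comap_map_weilDual_selmerGroup W (p ^ k) e hμ hadd₁ hadd₂ hgal inv 𝓕, hsd]
      exact hC
    exact h
  -- (2) `𝓖 = 𝓕(m)` and `𝓕 = 𝓕(c)` agree away from the places of `c` not dividing `m`
  have h𝓖𝓕 : ∀ v : HeightOneSpectrum (𝓞 K), v ∉ placesDividing K c \ placesDividing K m →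
      𝓖 (Sum.inr v) = 𝓕 (Sum.inr v) := by
    intro v hv
    rw [Finset.mem_sdiff, not_and, not_not] at hv
    rw [h𝓖, h𝓕, selmerF_inr, selmerF_inr]
    by_cases hc : v ∈ placesDividing K c
    · rw [if_pos (hv hc), if_pos hc]
    · rw [if_neg (fun hm ↦ hc (hmc hm)), if_neg hc]
  -- (3) an exceptional set of places containing those of `c`
  obtain ⟨S, T, hPT, hST, -, -, -, h𝓚⟩ := exists_symmetric_exceptional W (1 : K ≃ₐ[ℚ] K) p k
    (mul_one 1) (placesDividing K c)
  have hcS : ∀ v ∈ placesDividing K c, (Sum.inr v : Place K) ∈ S := fun v hv =>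
    (hST v).mpr (hPT hv)
  have h𝓕unr : 𝓕.IsUnramifiedOutside S := selmerF_isUnramifiedOutside W ((p ^ k : ℕ) : ℤ) 𝒯 h𝓚 hcS
  have h𝓖unr : 𝓖.IsUnramifiedOutside S :=
    selmerF_isUnramifiedOutside W ((p ^ k : ℕ) : ℤ) 𝒯 h𝓚 (fun v hv ↦ hcS v (hmc hv))
  have hinf : ∀ u : InfinitePlace K, 𝓕 (Sum.inl u) = 𝓖 (Sum.inl u) := fun u ↦ by
    rw [h𝓕, h𝓖, selmerF_inl, selmerF_inl]
  -- (4) Poitou–Tate: the sum of the local terms over the finite places of `S` vanishes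
  have hsum := sum_localTatePairingZMod_selmer_eq_zero (ρ := ((W.baseChange K).torsionGaloisModule ((p ^ k : ℕ) : ℤ)))
    hvan hM S T hST h𝓕unr h𝓖unr hinf hw hyd
  -- (5) every term off `placesDividing c \ placesDividing m` vanishes (the structures agree there)
  have hDT : placesDividing K c \ placesDividing K m ⊆ T := fun v hv ↦ hPT (Finset.mem_sdiff.mp hv).1
  rw [← Finset.sum_subset hDT] at hsum
  · exact hsum
  · intro t _ ht
    have hwt : galoisCohomology.localization ((W.baseChange K).torsionGaloisModule ((p ^ k : ℕ) : ℤ)) (Sum.inr t) 1 w ∈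
        𝓕 (Sum.inr t) := by
      rw [← h𝓖𝓕 t ht]
      exact ((𝓖.mem_selmerGroup_iff w).mp hw) (Sum.inr t)
    have hyt := ((SelmerStructure.mem_selmerGroup_iff _ y).mp hyd) (Sum.inr t)
    rw [LocalInvariants.dualSelmerStructure_apply, LocalInvariants.mem_dualLocalCondition_iff] at hyt
    exact hyt _ hwt

include halt hnondeg in
/-- **The OSR shape**: `c = n·ℓ` with `m ∣ n·ℓ ≠ 0`; the sum runs over the places of `n·ℓ` not dividing `m` (with `m ∣ n`, `ℓ ∤ n`: the
places of the seed block `n/m` and the place of `ℓ`).  [cite: Kolyvagin1991MathAnn, §2] [cite: McCallumLMS1991, §5] -/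
theorem sum_localTatePairing_eq_zero_of_dvd (hK : IsImaginaryQuadratic K) (hk : 1 ≤ k)
    (inv : LocalInvariants K (p ^ k))
    (hinv : ∀ v : HeightOneSpectrum (𝓞 K), Injective (inv (Sum.inr v)))
    (hvan : inv.SumLocalTermEqZero)
    (𝒯 : SelmerStructure ((W.baseChange K).torsionGaloisModule ((p ^ k : ℕ) : ℤ))) {c m : ℕ} (hc : c ≠ 0) (hmc : m ∣ c)
    (h𝒯sd : ∀ v ∈ placesDividing K c,
      inv.dualTransported 𝒯 (weilDualIntertwining (W.baseChange K) (p ^ k) e hμ hadd₁ hadd₂ hgal) (Sum.inr v) =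
        𝒯 (Sum.inr v))
    (w C : galoisCohomology ((W.baseChange K).torsionGaloisModule ((p ^ k : ℕ) : ℤ)) 1)
    (hw : w ∈ (selmerF W ((p ^ k : ℕ) : ℤ) 𝒯 (placesDividing K m)).selmerGroup)
    (hC : C ∈ (selmerF W ((p ^ k : ℕ) : ℤ) 𝒯 (placesDividing K c)).selmerGroup) :
    ∑ v ∈ placesDividing K c \ placesDividing K m,
      localTatePairingZMod ((W.baseChange K).torsionGaloisModule ((p ^ k : ℕ) : ℤ)) (p ^ k) (Sum.inr v) (inv (Sum.inr v))
        (galoisCohomology.localization ((W.baseChange K).torsionGaloisModule ((p ^ k : ℕ) : ℤ)) (Sum.inr v) 1 w)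
        (galoisCohomology.localization (((W.baseChange K).torsionGaloisModule ((p ^ k : ℕ) : ℤ)).tateDual (p ^ k)) (Sum.inr v) 1
          (galoisCohomology.map (weilDualIntertwining (W.baseChange K) (p ^ k) e hμ hadd₁ hadd₂ hgal) 1 C)) = 0 :=
  sum_localTatePairing_eq_zero_of_placesDividing_subset W p k e hμ hadd₁ hadd₂ hgal halt hnondeg hK hk inv hinv hvan 𝒯
    h𝒯sd (KolyvaginAtTwo.RegularWalk.placesDividing_subset_of_dvd (K := K) hc hmc) w C hw hC

end KTerm

/-! ## §1½  A structure lemma: shrinking the transverse set of `𝓕(S)` -/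

section Structure

variable {K : Type} [Field K] [NumberField K] (W : WeierstrassCurve ℚ)

/-- **Shrinking the transverse set.**  If `x ∈ H¹_{𝓕(S)}` (transverse `𝒰` at `S`, Kummer elsewhere) is Kummer at the places of
`S` outside `S' ⊆ S`, then `x ∈ H¹_{𝓕(S')}`.  [cite: Jetchev2008, §3.4.1 (p. 816)] [folklore] -/
theorem mem_selmerGroup_selmerF_of_subset (n : ℤ) (𝒰 : SelmerStructure ((W.baseChange K).torsionGaloisModule n))
    {S S' : Finset (HeightOneSpectrum (𝓞 K))} (hS : S' ⊆ S)
    (x : galoisCohomology ((W.baseChange K).torsionGaloisModule n) 1)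
    (hx : x ∈ (selmerF W n 𝒰 S).selmerGroup)
    (hKum : ∀ w ∈ S, w ∉ S' →
      galoisCohomology.localization ((W.baseChange K).torsionGaloisModule n) (Sum.inr w) 1 x ∈
        (W.baseChange K).kummerSelmerStructure n (Sum.inr w)) :
    x ∈ (selmerF W n 𝒰 S').selmerGroup := by
  have hx' := (SelmerStructure.mem_selmerGroup_iff _ x).mp hx
  refine (SelmerStructure.mem_selmerGroup_iff _ x).mpr fun v ↦ ?_
  rcases v with u | w
  · simpa only [selmerF_inl] using hx' (Sum.inl u)
  · have h := hx' (Sum.inr w)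
    by_cases hw' : w ∈ S'
    · rw [selmerF_inr, if_pos (hS hw')] at h
      rw [selmerF_inr, if_pos hw']
      exact h
    · rw [selmerF_inr, if_neg hw']
      by_cases hw : w ∈ S
      · exact hKum w hw hw'
      · rwa [selmerF_inr, if_neg hw] at h

end Structure

end Summit.BirchSwinnertonDyer.BirchSwinnertonDyer.Theorems.KolyvaginLowerBoundAtTwo

end
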